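/-
Copyright (c) 2026. All rights reserved.
Released under Apache 2.0 license as described in the file LICENSE.
Authors: abc-iut cell, wave-5 seat abc-iut-w5-d141 (L3 sub-DAG [SemiAnbd] Thm 5.4, row T54-7, packaging).
-/
import Literature.AnabelianGeometry.SemiGraphs.ArithQuasiGeometricSurjective
import Literature.AnabelianGeometry.SemiGraphs.ArithQuasiGeometricRelSlim
import HarnessLib

/-!
# [SemiAnbd] Theorem 5.4 (iii), clause 3: packaging with the producer's currency for relative temp-slimness
# (sub-DAG SemiAnbd-Thm54, row T54-7; proof-only)

Mochizuki, *Semi-graphs of anabelioids*, Publ. RIMS **42** (2006), §5, Thm 5.4 (iii), p. 66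
[cite: MochizukiSemiAnbd2006, Thm 5.4 (iii), p. 66].  PROOF-ONLY: `Thm54iii.clause3_of_geometric'` =
`Thm54iii.clause3_of_geometric` (abc-iut-w5-d141, `ArithQuasiGeometricSurjective.lean`) with its binder `hZ`
(relative temp-slimness) replaced by the producer's standard inputs via `relSlim_of_commensurator_slim`
(`ArithQuasiGeometricRelSlim.lean`): Rmk 5.3.1 on the `ℍ`-side (`hRH`, row T54-1, as in the coordinator's
umbrella), the commensurator description `hcommV'` of p. 65, continuity of `augH'`, and slimness of the geometric
verticial subgroups of `Π^temp_ℍ` (verticial slimness / Prop 5.2 (iii)).  Nothing asserted; no side on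
[IUTchIII] Cor 3.12.
-/

namespace Literature.AnabelianGeometry.SemiGraphs

open _root_.CategoryTheory
open Literature.AlgebraicGeometry.Frobenioids (IsSlimGroup)

universe u v w uG uH uV uB uV' uB'

variable {Obj : Type u} [Category.{v} Obj] {𝓥 : SemiAnbdVocab.{u, v, w} Obj}
variable {𝔊 ℍ : ArithSemiGraph 𝓥} {e : 𝔊.PA ≃* ℍ.PA}
variable {Gtp : Type uG} [Group Gtp] [TopologicalSpace Gtp]
variable {Htp : Type uH} [Group Htp] [TopologicalSpace Htp] [IsTopologicalGroup Htp] [T2Space Htp]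
variable {V : Type uV} {B : Type uB} {V' : Type uV'} {B' : Type uB'}
variable {D : DecompositionData Gtp V B} {D' : DecompositionData Htp V' B'}

/-- **[SemiAnbd] Thm 5.4 (iii) clause 3 from geometric inputs, producer-currency form**: as
`Thm54iii.clause3_of_geometric`, with relative temp-slimness supplied by Rmk 5.3.1 on the `ℍ`-side, the
commensurator description of p. 65, continuity of `augH'` and slimness of the geometric verticial subgroups.
[cite: MochizukiSemiAnbd2006, Thm 5.4 (iii), p. 66] -/
theorem Thm54iii.clause3_of_geometric' (augG : Gtp →* 𝔊.PA) (augH' : Htp →* 𝔊.PA)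
    (btemp : (φ : ArithHom 𝓥 𝔊 ℍ) → φ.IsLocallyOpen → ArithHom.IsOverA 𝔊 ℍ e φ → (Gtp →* Htp))
    (hIIG : ArithMaximalCompactStatementII D augG) (hIIH : ArithMaximalCompactStatementII D' augH')
    (hRH : VerticialEdgeLikeCompactAmpleStatement D' augH') (haugH : Continuous augH')
    (hcommV' : ∀ w : V', Subgroup.Commensurable.commensurator (D'.vertGp w ⊓ augH'.ker) = D'.vertGp w)
    (hslim : ∀ (w : V') (x : Htp), IsSlimGroup (conjSubgroup x (D'.vertGp w) ⊓ augH'.ker : Subgroup Htp))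
    (hover : ∀ (φ : ArithHom 𝓥 𝔊 ℍ) (h₁ : φ.IsLocallyOpen) (h₂ : ArithHom.IsOverA 𝔊 ℍ e φ),
      augH'.comp (btemp φ h₁ h₂) = augG)
    (ι : (𝔊.G ⟶ ℍ.G) → (augG.ker →* Htp))
    (hιG : ∀ (g : 𝔊.G ⟶ ℍ.G) (a : 𝔊.PA) (γ : Gtp), augG γ = a → ∃ δ ∈ augH'.ker,
      ∀ x : augG.ker, ι ((𝔊.ρ a).hom ≫ g) x =
        δ * ι g ⟨γ * x * γ⁻¹, (MonoidHom.normal_ker augG).conj_mem _ x.2 γ⟩ * δ⁻¹)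
    (hιH : ∀ (g : 𝔊.G ⟶ ℍ.G) (a : 𝔊.PA) (η : Htp), augH' η = a → ∃ δ ∈ augH'.ker,
      ∀ x : augG.ker, ι (g ≫ (ℍ.ρ (e a)).hom) x = δ * (η * ι g x * η⁻¹) * δ⁻¹)
    (hιinj : ∀ g₁ g₂ : 𝔊.G ⟶ ℍ.G,
      (∃ δ ∈ augH'.ker, ∀ x : augG.ker, ι g₁ x = δ * ι g₂ x * δ⁻¹) → g₁ = g₂)
    (hιbtemp : ∀ (φ : ArithHom 𝓥 𝔊 ℍ) (h₁ : φ.IsLocallyOpen) (h₂ : ArithHom.IsOverA 𝔊 ℍ e φ),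
      ∃ δ ∈ augH'.ker, ∀ x : augG.ker, btemp φ h₁ h₂ x = δ * ι φ.geom x * δ⁻¹)
    (hCor39 : ∀ f : Gtp →* Htp, Continuous f → augH'.comp f = augG →
      (∀ v : V, ∃ (w : V') (x : Htp),
        MapsOntoOpenSubgroupOf f (D.vertGp v ⊓ augG.ker) (conjSubgroup x (D'.vertGp w) ⊓ augH'.ker)) →
      (∀ b : B, ∃ (b' : B') (x : Htp),
        MapsOntoOpenSubgroupOf f (D.brGp b ⊓ augG.ker) (conjSubgroup x (D'.brGp b') ⊓ augH'.ker)) →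
      ∃ (g : 𝔊.G ⟶ ℍ.G), ∃ h ∈ augH'.ker, ∀ x : augG.ker, f x = h * ι g x * h⁻¹)
    (hsurjG : Function.Surjective augG) (he : Continuous e) (hV : Nonempty V) :
    ∀ f : Gtp →* Htp, IsArithQuasiGeometric augG augH' f →
      ∃ (φ : ArithHom 𝓥 𝔊 ℍ) (h₁ : φ.IsLocallyOpen) (h₂ : ArithHom.IsOverA 𝔊 ℍ e φ) (h : Htp),
        ∀ g, f g = h * btemp φ h₁ h₂ g * h⁻¹ :=
  Thm54iii.clause3_of_geometric augG augH' btemp hIIG hIIH hover ι hιG hιH hιinj hιbtemp hCor39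
    (relSlim_of_commensurator_slim haugH hcommV'
      (fun w => (hRH _ (Or.inl ⟨w, 1, by ext y; simp [conjSubgroup]⟩)).1) hslim)
    hsurjG he hV

end Literature.AnabelianGeometry.SemiGraphs
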